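import Literature.Analysis.FluidPDE.GIPRemainderWindowLimit
import Literature.Analysis.FluidPDE.GIPKatoSmallData
import Literature.Analysis.FluidPDE.GIPHeatDecayThree
import Literature.Analysis.FluidPDE.SobolevWeakGradient
import Literature.Analysis.FluidPDE.MildL3SmoothHolds
import HarnessLib

/-!
# Gallagher–Iftimie–Planchon: global `L³` solutions decay (Thm. 0.1 (i), via Thm. 2.1)

Analysis/FluidPDE support file (theorems only) on the discharge path of
`Literature.Analysis.FluidPDE.GIP2003_L3_stability`: **a global Kato solution of the
Navier–Stokes equations with `L³(ℝ³)` datum tends to zero in `L³`**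
(`GIP2003.tendsto_eLpNorm_three_of_global`).

The printed proof (GIP 2003, Thm. 2.1, pp. 1395–1397) splits the datum into a small `L³` part and
an `L²` part and runs an energy estimate on the remainder; here the splitting is done with the
caloric background `e(τ) = e^{τΔ}ũ₀` of a bounded representative `ũ₀` of an (essentially bounded)
slice of the solution (`GIP2003.kato_remainder_window_inequality`): on a window `[a, b]` far out,
where `‖e(τ)‖₃ ≤ η` (heat decay in `L³`, `GIP2003.tendsto_eLpNorm_heatExtension_three_atTop`),
the remainder `v = u - e` has finite energy, `‖v(τ)‖₂² ≤ W` and `∫_a^b ‖Dv‖₂² ≤ W` with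
`W = ‖v(a)‖₂² + 4∫_a^b‖e‖₄⁴ = ‖v(a)‖₂² + O(η³√b)`; by averaging, Sobolev (`‖v‖₆ ≤ K‖Dv‖₂`) and
interpolation (`‖v‖₃⁴ ≤ ‖v‖₂²‖v‖₆²`) some slice has `‖v(τ)‖₃ ≤ ε/2`, whence `‖u(τ)‖₃ ≤ ε`; the
small-data theory (`GIP2003.tendsto_zero_of_forall_exists_small`) concludes.

## References

* I. Gallagher, D. Iftimie, F. Planchon, Ann. Inst. Fourier 53 (2003), Thm. 0.1 (i), Thm. 2.1
  and its proof pp. 1395–1397. [GallagherIftimiePlanchon2003]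
-/

noncomputable section

open MeasureTheory TopologicalSpace Set Function Filter Metric InnerProductSpace
open _root_.Topology
open scoped ENNReal NNReal RealInnerProductSpace

namespace Literature.Analysis.FluidPDE

namespace GIP2003

section Tools

/-- **Slice bound by Sobolev and interpolation**: for a `C¹` field `V` on `ℝ³` with finite energy,
`‖V‖₃⁴ ≤ K² ‖V‖₂² ‖DV‖₂²` (`‖V‖₃ ≤ ‖V‖₂^{1/2}‖V‖₆^{1/2}`, `‖V‖₆ ≤ K‖DV‖₂`).
(GIP 2003, proof of Thm. 2.1, p. 1397.) [cite: GallagherIftimiePlanchon2003, Thm. 2.1 (proof)] -/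
theorem eLpNorm_three_rpow_four_le {V : EuclideanSpace ℝ (Fin 3) → EuclideanSpace ℝ (Fin 3)}
    (hV : ContDiff ℝ 1 V) (hV2 : ∫⁻ x, ‖V x‖ₑ ^ 2 < ⊤) :
    eLpNorm V 3 volume ^ (4 : ℝ) ≤
      (SNormLESNormFDerivOfEqConst (EuclideanSpace ℝ (Fin 3))
          (volume : Measure (EuclideanSpace ℝ (Fin 3))) 2 : ℝ≥0∞) ^ 2 *
        (∫⁻ x, ‖V x‖ₑ ^ 2) * ∫⁻ x, ENNReal.ofReal (frobeniusNormSq (fderiv ℝ V x)) := by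
  set Ks : ℝ≥0 := SNormLESNormFDerivOfEqConst (EuclideanSpace ℝ (Fin 3))
    (volume : Measure (EuclideanSpace ℝ (Fin 3))) 2 with hKs
  set D : ℝ≥0∞ := ∫⁻ x, ENNReal.ofReal (frobeniusNormSq (fderiv ℝ V x)) with hD
  have hE : Module.finrank ℝ (EuclideanSpace ℝ (Fin 3)) = 3 := finrank_euclideanSpace_fin
  have hmeas : AEStronglyMeasurable V volume := hV.continuous.aestronglyMeasurable
  have hY : ∫⁻ x, ‖V x‖ₑ ^ 2 = ∫⁻ x, ‖V x‖ₑ ^ (2 : ℝ) :=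
    lintegral_congr fun x => (ENNReal.rpow_ofNat _ 2).symm
  have h2 : eLpNorm V 2 volume < ⊤ := by
    rw [eLpNorm_eq_lintegral_rpow_enorm_toReal two_ne_zero ENNReal.ofNat_ne_top, ENNReal.toReal_ofNat, ← hY]
    exact ENNReal.rpow_lt_top_of_nonneg (by norm_num) hV2.ne
  have h6 := eLpNorm_six_le_lintegral_frobeniusNormSq_weakGradient hE
    (hasWeakGradient_fderiv_of_contDiff hV) h2
  have hS6 : ∫⁻ x, ‖V x‖ₑ ^ (6 : ℝ) ≤ (Ks : ℝ≥0∞) ^ (6 : ℝ) * D ^ (3 : ℝ) := by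
    have h : ∫⁻ x, ‖V x‖ₑ ^ (6 : ℝ) = eLpNorm V 6 volume ^ (6 : ℝ) := by
      rw [eLpNorm_eq_lintegral_rpow_enorm_toReal (by norm_num) (by norm_num), ENNReal.toReal_ofNat,
        ← ENNReal.rpow_mul]
      norm_num
    rw [h]
    calc eLpNorm V 6 volume ^ (6 : ℝ) ≤ ((Ks : ℝ≥0∞) * D ^ (1 / 2 : ℝ)) ^ (6 : ℝ) :=
          ENNReal.rpow_le_rpow h6 (by norm_num)
      _ = (Ks : ℝ≥0∞) ^ (6 : ℝ) * D ^ (3 : ℝ) := by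
          rw [ENNReal.mul_rpow_of_nonneg _ _ (by norm_num), ← ENNReal.rpow_mul]
          norm_num
  have hinterp := lintegral_enorm_cube_le_interp (μ := volume) hmeas
  have h3 : eLpNorm V 3 volume ^ (4 : ℝ) = (∫⁻ x, ‖V x‖ₑ ^ (3 : ℝ)) ^ (4 / 3 : ℝ) := by
    rw [eLpNorm_eq_lintegral_rpow_enorm_toReal (by norm_num) (by norm_num), ENNReal.toReal_ofNat,
      ← ENNReal.rpow_mul]
    norm_num
  calc eLpNorm V 3 volume ^ (4 : ℝ) = (∫⁻ x, ‖V x‖ₑ ^ (3 : ℝ)) ^ (4 / 3 : ℝ) := h3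
    _ ≤ ((∫⁻ x, ‖V x‖ₑ ^ (2 : ℝ)) ^ (3 / 4 : ℝ) * (∫⁻ x, ‖V x‖ₑ ^ (6 : ℝ)) ^ (1 / 4 : ℝ)) ^ (4 / 3 : ℝ) :=
        ENNReal.rpow_le_rpow hinterp (by norm_num)
    _ = (∫⁻ x, ‖V x‖ₑ ^ (2 : ℝ)) * (∫⁻ x, ‖V x‖ₑ ^ (6 : ℝ)) ^ (1 / 3 : ℝ) := by
        rw [ENNReal.mul_rpow_of_nonneg _ _ (by norm_num), ← ENNReal.rpow_mul, ← ENNReal.rpow_mul]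
        norm_num
    _ ≤ (∫⁻ x, ‖V x‖ₑ ^ (2 : ℝ)) * ((Ks : ℝ≥0∞) ^ (6 : ℝ) * D ^ (3 : ℝ)) ^ (1 / 3 : ℝ) :=
        mul_le_mul' le_rfl (ENNReal.rpow_le_rpow hS6 (by norm_num))
    _ = (∫⁻ x, ‖V x‖ₑ ^ (2 : ℝ)) * ((Ks : ℝ≥0∞) ^ (2 : ℝ) * D) := by
        rw [ENNReal.mul_rpow_of_nonneg _ _ (by norm_num), ← ENNReal.rpow_mul, ← ENNReal.rpow_mul]
        norm_num
    _ = (Ks : ℝ≥0∞) ^ 2 * (∫⁻ x, ‖V x‖ₑ ^ 2) * D := by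
        rw [hY, ENNReal.rpow_ofNat]
        ring

/-- **Averaging**: if `∫_a^b f ≤ W < ∞` then some `t ∈ (a, b)` has `f t ≤ W/(b - a) + θ`
(`θ > 0`). [folklore] -/
theorem exists_mem_Ioo_le_of_setLIntegral_le {f : ℝ → ℝ≥0∞} {a b : ℝ} (hab : a < b) {W : ℝ≥0∞}
    (hW : W ≠ ⊤) (hf : ∫⁻ t in Ioo a b, f t ≤ W) {θ : ℝ} (hθ : 0 < θ) :
    ∃ t ∈ Ioo a b, f t ≤ W / ENNReal.ofReal (b - a) + ENNReal.ofReal θ := by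
  by_contra hne
  push Not at hne
  have hL0 : ENNReal.ofReal (b - a) ≠ 0 := (ENNReal.ofReal_pos.2 (by linarith)).ne'
  have hlow : (W / ENNReal.ofReal (b - a) + ENNReal.ofReal θ) * volume (Ioo a b) ≤ ∫⁻ t in Ioo a b, f t := by
    rw [← setLIntegral_const]
    exact setLIntegral_mono' measurableSet_Ioo fun t ht => (hne t ht).le
  rw [Real.volume_Ioo, add_mul, ENNReal.div_mul_cancel hL0 ENNReal.ofReal_ne_top] at hlow
  have hpos : ENNReal.ofReal θ * ENNReal.ofReal (b - a) ≠ 0 :=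
    mul_ne_zero (ENNReal.ofReal_pos.2 hθ).ne' hL0
  exact absurd (hlow.trans hf) (not_le.2 (ENNReal.lt_add_right hW hpos))

/-- `∫_a^b τ^{-1/2} dτ ≤ 2√b` for `1 ≤ a ≤ b`. [folklore] -/
theorem setIntegral_rpow_neg_half_le {a b : ℝ} (ha : 1 ≤ a) (hab : a ≤ b) :
    ∫ τ in Ioo a b, τ ^ (-(1 / 2 : ℝ)) ≤ 2 * Real.sqrt b := by
  have h0 : (0 : ℝ) ∉ uIcc a b := by
    rw [uIcc_of_le hab]
    intro h
    linarith [h.1]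
  rw [← integral_Ioc_eq_integral_Ioo, ← intervalIntegral.integral_of_le hab,
    integral_rpow (Or.inr ⟨by norm_num, h0⟩)]
  have hb : 0 ≤ b := by linarith
  have h1 : b ^ (-(1 / 2 : ℝ) + 1) = Real.sqrt b := by
    rw [show (-(1 / 2 : ℝ) + 1) = 1 / 2 by norm_num, Real.sqrt_eq_rpow]
  have h2 : 0 ≤ a ^ (-(1 / 2 : ℝ) + 1) := Real.rpow_nonneg (by linarith) _
  rw [h1, show (-(1 / 2 : ℝ) + 1) = 1 / 2 by norm_num] at *
  rw [div_le_iff₀ (by norm_num : (0 : ℝ) < 1 / 2)]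
  nlinarith [Real.sqrt_nonneg b]

/-- **The source term on a far window**: if `‖e^{τΔ}ũ₀‖₃ ≤ η` on `[a, b]`, `1 ≤ a`, then
`∫_a^b ∫ |e^{τΔ}ũ₀|⁴ ≤ 2√b η³ ‖ũ₀‖₃` (pointwise heat bound `|e^{τΔ}ũ₀| ≤ (4πτ)^{-1/2}‖ũ₀‖₃`
and `∫|e|⁴ ≤ ‖e‖_∞ ‖e‖₃³`). [folklore] -/
theorem lintegral_heatFlow_pow_four_le {ũ₀ : EuclideanSpace ℝ (Fin 3) → EuclideanSpace ℝ (Fin 3)}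
    (hũ₀ : MemLp ũ₀ 3 volume) {η a b : ℝ} (hη : 0 ≤ η) (ha : 1 ≤ a) (hab : a ≤ b)
    (hsmall : ∀ τ ∈ Icc a b, eLpNorm (heatFlow ũ₀ τ) 3 volume ≤ ENNReal.ofReal η) :
    ∫⁻ τ in Ioo a b, ∫⁻ x, ‖heatFlow ũ₀ (1 * τ) x‖ₑ ^ 4 ≤
      ENNReal.ofReal (2 * Real.sqrt b * η ^ 3 * (eLpNorm ũ₀ 3 volume).toReal) := by
  set N₀ : ℝ := (eLpNorm ũ₀ 3 volume).toReal with hN₀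
  have hN₀0 : 0 ≤ N₀ := ENNReal.toReal_nonneg
  have hE : Module.finrank ℝ (EuclideanSpace ℝ (Fin 3)) = 3 := finrank_euclideanSpace_fin
  have h13 : (1 : ℝ≥0∞) ≤ 3 := by norm_num
  -- the slice bound
  have hslice : ∀ τ ∈ Ioo a b, ∫⁻ x, ‖heatFlow ũ₀ (1 * τ) x‖ₑ ^ 4 ≤
      ENNReal.ofReal (N₀ * η ^ 3 * τ ^ (-(1 / 2 : ℝ))) := by
    intro τ hτ
    have hτ0 : 0 < τ := by linarith [hτ.1]
    have hpt : ∀ x, ‖heatFlow ũ₀ (1 * τ) x‖ ≤ τ ^ (-(1 / 2 : ℝ)) * N₀ := by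
      intro x
      have h := norm_heatTest_le_of_memLp_three hE one_pos hũ₀ hτ0 x
      have h4π : (4 * Real.pi * (1 * τ)) ^ (-(1 / 2 : ℝ)) ≤ τ ^ (-(1 / 2 : ℝ)) := by
        apply Real.rpow_le_rpow_of_nonpos hτ0 ?_ (by norm_num)
        nlinarith [Real.pi_gt_three]
      exact h.trans (mul_le_mul_of_nonneg_right h4π hN₀0)
    have h1 := (lintegral_enorm_pow_four_le_of_bound (memLp_heatFlow_holds hũ₀ h13 (by positivity)) hpt).1
    have h3 : eLpNorm (heatFlow ũ₀ (1 * τ)) 3 volume ≤ ENNReal.ofReal η := by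
      rw [one_mul]; exact hsmall τ (Ioo_subset_Icc_self hτ)
    calc ∫⁻ x, ‖heatFlow ũ₀ (1 * τ) x‖ₑ ^ 4 = ∫⁻ x, ‖heatFlow ũ₀ (1 * τ) x‖ₑ ^ (4 : ℝ) :=
          lintegral_congr fun x => (ENNReal.rpow_ofNat _ 4).symm
      _ ≤ ENNReal.ofReal (τ ^ (-(1 / 2 : ℝ)) * N₀) * ENNReal.ofReal η ^ (3 : ℝ) :=
          h1.trans (mul_le_mul' le_rfl (ENNReal.rpow_le_rpow h3 (by norm_num)))
      _ = ENNReal.ofReal (N₀ * η ^ 3 * τ ^ (-(1 / 2 : ℝ))) := by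
          rw [ENNReal.ofReal_rpow_of_nonneg hη (by norm_num), ← ENNReal.ofReal_mul (by positivity),
            show (3 : ℝ) = ((3 : ℕ) : ℝ) by norm_num, Real.rpow_natCast]
          congr 1
          ring
  -- integrate in `τ`
  have hcont : ContinuousOn (fun τ : ℝ => τ ^ (-(1 / 2 : ℝ))) (Icc a b) :=
    continuousOn_id.rpow_const fun τ hτ => Or.inl (by simp only [id]; linarith [hτ.1])
  have hint : IntegrableOn (fun τ : ℝ => N₀ * η ^ 3 * τ ^ (-(1 / 2 : ℝ))) (Ioo a b) volume :=
    ((hcont.integrableOn_compact isCompact_Icc).mono_set Ioo_subset_Icc_self).const_mul _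
  have hnn : 0 ≤ᵐ[volume.restrict (Ioo a b)] fun τ : ℝ => N₀ * η ^ 3 * τ ^ (-(1 / 2 : ℝ)) := by
    filter_upwards [ae_restrict_mem measurableSet_Ioo] with τ hτ
    have : 0 ≤ τ ^ (-(1 / 2 : ℝ)) := Real.rpow_nonneg (by linarith [hτ.1]) _
    positivity
  calc ∫⁻ τ in Ioo a b, ∫⁻ x, ‖heatFlow ũ₀ (1 * τ) x‖ₑ ^ 4
      ≤ ∫⁻ τ in Ioo a b, ENNReal.ofReal (N₀ * η ^ 3 * τ ^ (-(1 / 2 : ℝ))) :=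
        setLIntegral_mono' measurableSet_Ioo hslice
    _ = ENNReal.ofReal (∫ τ in Ioo a b, N₀ * η ^ 3 * τ ^ (-(1 / 2 : ℝ))) :=
        (ofReal_integral_eq_lintegral_ofReal hint hnn).symm
    _ ≤ ENNReal.ofReal (2 * Real.sqrt b * η ^ 3 * N₀) := by
        refine ENNReal.ofReal_le_ofReal ?_
        rw [integral_const_mul]
        have hI := setIntegral_rpow_neg_half_le ha hab
        have hc : 0 ≤ N₀ * η ^ 3 := by positivity
        nlinarith [mul_le_mul_of_nonneg_left hI hc]

/-- The real arithmetic of the choice of constants in the decay proof. [folklore] -/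
theorem decay_arith {ε k N y η L θ b : ℝ} (hk : 0 ≤ k) (hN : 0 ≤ N) (hy : 0 ≤ y)
    (hη0 : 0 ≤ η) (hη1 : η ≤ 1) (hηε : η ≤ ε / 2) (hηN : 2048 * k * N ^ 2 * η ≤ 1)
    (hL0 : 0 < L) (hbL : b ≤ 2 * L) (hb0 : 0 ≤ b) (hLy : 16 * k * y ^ 2 ≤ L * (ε / 2) ^ 4)
    (hθ : θ = (ε / 2) ^ 4 / (4 * (k * (y + 8 * Real.sqrt b * η ^ 3 * N) + 1))) :
    k * (y + 8 * Real.sqrt b * η ^ 3 * N) * ((y + 8 * Real.sqrt b * η ^ 3 * N) / L + θ) ≤ (ε / 2) ^ 4 := by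
  set W : ℝ := y + 8 * Real.sqrt b * η ^ 3 * N with hW
  have hW0 : 0 ≤ W := by positivity
  have hε4 : 0 ≤ (ε / 2) ^ 4 := by positivity
  -- the `θ` part
  have h1 : k * W * θ ≤ (ε / 2) ^ 4 / 4 := by
    rw [hθ]
    have hden : 0 < 4 * (k * W + 1) := by positivity
    rw [mul_div_assoc', div_le_div_iff₀ hden (by norm_num : (0 : ℝ) < 4)]
    nlinarith [mul_nonneg hk hW0]
  -- the `W²/L` part
  have hsq : W ^ 2 ≤ 2 * y ^ 2 + 256 * L * η ^ 6 * N ^ 2 := by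
    have hs : Real.sqrt b ^ 2 = b := Real.sq_sqrt hb0
    have h2 : W ^ 2 ≤ 2 * y ^ 2 + 2 * (8 * Real.sqrt b * η ^ 3 * N) ^ 2 := by
      rw [hW]; nlinarith [sq_nonneg (y - 8 * Real.sqrt b * η ^ 3 * N)]
    have h3 : (8 * Real.sqrt b * η ^ 3 * N) ^ 2 = 64 * b * η ^ 6 * N ^ 2 := by
      rw [show (8 * Real.sqrt b * η ^ 3 * N) ^ 2 = 64 * Real.sqrt b ^ 2 * (η ^ 3) ^ 2 * N ^ 2 by ring, hs]
      ring
    rw [h3] at h2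
    have h4 : 64 * b * η ^ 6 * N ^ 2 ≤ 128 * L * η ^ 6 * N ^ 2 := by
      have : 0 ≤ η ^ 6 * N ^ 2 := by positivity
      nlinarith
    linarith
  have hη6 : η ^ 6 ≤ (ε / 2) ^ 4 * η := by
    have h4 : η ^ 4 ≤ (ε / 2) ^ 4 := pow_le_pow_left₀ hη0 hηε 4
    have h2' : η ^ 2 ≤ η := by nlinarith
    calc η ^ 6 = η ^ 4 * η ^ 2 := by ring
      _ ≤ (ε / 2) ^ 4 * η := mul_le_mul h4 h2' (by positivity) hε4
  have h2 : k * W * (W / L) ≤ (ε / 2) ^ 4 / 4 := by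
    rw [show k * W * (W / L) = k * W ^ 2 / L by ring, div_le_iff₀ hL0]
    have hA : k * (2 * y ^ 2) ≤ L * (ε / 2) ^ 4 / 8 := by nlinarith
    have hB : k * (256 * L * η ^ 6 * N ^ 2) ≤ L * (ε / 2) ^ 4 / 8 := by
      have h5 : k * (256 * L * η ^ 6 * N ^ 2) ≤ k * (256 * L * ((ε / 2) ^ 4 * η) * N ^ 2) := by
        have : 0 ≤ k * 256 * L * N ^ 2 := by positivity
        nlinarith
      have h6 : k * (256 * L * ((ε / 2) ^ 4 * η) * N ^ 2) = L * (ε / 2) ^ 4 * (256 * k * N ^ 2 * η) := by ring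
      have h7 : 256 * k * N ^ 2 * η ≤ 1 / 8 := by nlinarith
      have h8 : 0 ≤ L * (ε / 2) ^ 4 := by positivity
      nlinarith
    calc k * W ^ 2 ≤ k * (2 * y ^ 2 + 256 * L * η ^ 6 * N ^ 2) := mul_le_mul_of_nonneg_left hsq hk
      _ = k * (2 * y ^ 2) + k * (256 * L * η ^ 6 * N ^ 2) := by ring
      _ ≤ L * (ε / 2) ^ 4 / 8 + L * (ε / 2) ^ 4 / 8 := add_le_add hA hB
      _ = (ε / 2) ^ 4 / 4 * L := by ring
  calc k * W * (W / L + θ) = k * W * (W / L) + k * W * θ := by ring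
    _ ≤ (ε / 2) ^ 4 / 4 + (ε / 2) ^ 4 / 4 := add_le_add h2 h1
    _ ≤ (ε / 2) ^ 4 := by linarith

end Tools

/-! ### The decay theorem -/

section Decay

/-- **Global `L³` solutions decay** (Gallagher–Iftimie–Planchon 2003, Thm. 0.1 (i); Thm. 2.1 for
`X = L³(ℝ³)`): a global Kato solution `u ∈ C([0,∞); L³)` of the Navier–Stokes equations (`ν = 1`)
satisfies `‖u(t)‖₃ → 0` as `t → ∞`.
[cite: GallagherIftimiePlanchon2003, Thm. 0.1 (i), Thm. 2.1 (proof pp. 1395–1397)] -/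
theorem tendsto_eLpNorm_three_of_global
    {u₀ : EuclideanSpace ℝ (Fin 3) → EuclideanSpace ℝ (Fin 3)}
    {u : ℝ → EuclideanSpace ℝ (Fin 3) → EuclideanSpace ℝ (Fin 3)}
    (hu : ∀ T : ℝ, 0 < T → IsKatoSolutionOn T 1 u₀ u) :
    Tendsto (fun t => eLpNorm (u t) 3 volume) atTop (𝓝 0) := by
  refine tendsto_zero_of_forall_exists_small hu fun ε hε => ?_
  -- ### Step 0: an essentially bounded slice `u t₁` and the restarted solution `U = u(· + t₁)`
  obtain ⟨M, hM⟩ := (hu 2 two_pos).exists_ae_norm_le_of_pos one_pos (a := 1 / 2) (S := 3 / 2)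
    (by norm_num) (by norm_num)
  have hM' : ∀ᵐ t ∂((volume : Measure ℝ).restrict (Ioo (1 / 2 : ℝ) (3 / 2))),
      ∀ᵐ x ∂(volume : Measure (EuclideanSpace ℝ (Fin 3))), ‖u t x‖ ≤ M := by
    rw [volume_restrict_prod_univ_eq_prod] at hM
    filter_upwards [Measure.ae_ae_of_ae_prod hM] with t ht
    filter_upwards [ht] with x hx
    exact hx
  obtain ⟨t₁, ht₁, hbd⟩ : ∃ t₁ ∈ Ioo (1 / 2 : ℝ) (3 / 2),
      ∀ᵐ x ∂(volume : Measure (EuclideanSpace ℝ (Fin 3))), ‖u t₁ x‖ ≤ M := by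
    haveI : (ae ((volume : Measure ℝ).restrict (Ioo (1 / 2 : ℝ) (3 / 2)))).NeBot := by
      rw [ae_neBot, Ne, Measure.restrict_eq_zero, Real.volume_Ioo]
      norm_num
    obtain ⟨t₁, h1, h2⟩ := (hM'.and (ae_restrict_mem measurableSet_Ioo)).exists
    exact ⟨t₁, h2, h1⟩
  have ht₁0 : 0 ≤ t₁ := by linarith [ht₁.1]
  set U : ℝ → EuclideanSpace ℝ (Fin 3) → EuclideanSpace ℝ (Fin 3) := fun t => u (t + t₁) with hUdef
  have hU : ∀ T : ℝ, 0 < T → IsKatoSolutionOn T 1 (u t₁) U := fun T _ =>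
    isKatoSolutionOn_translate hu ht₁0 T
  obtain ⟨ũ₀, hMb, hae₀⟩ := exists_forall_norm_le_ae_eq hbd
  have hũ₀3 : MemLp ũ₀ 3 volume := ((hU 1 one_pos).memLp_initial one_pos).ae_eq hae₀
  have hdiv₀ : IsWeaklyDivFree ũ₀ := ((hU 1 one_pos).isWeaklyDivFree_initial one_pos).congr_ae hae₀
  set N₀ : ℝ := (eLpNorm ũ₀ 3 volume).toReal with hN₀
  have hN₀0 : 0 ≤ N₀ := ENNReal.toReal_nonneg
  -- ### Step 1: the constants and `η`
  set K : ℝ := (eLpNormLESNormFDerivOfEqInnerConst (volume : Measure (EuclideanSpace ℝ (Fin 3))) 2 : ℝ)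
    with hK
  have hK0 : 0 ≤ K := NNReal.coe_nonneg _
  set Ks : ℝ≥0 := SNormLESNormFDerivOfEqConst (EuclideanSpace ℝ (Fin 3))
    (volume : Measure (EuclideanSpace ℝ (Fin 3))) 2 with hKs
  set k : ℝ := (Ks : ℝ) ^ 2 with hk
  have hk0 : 0 ≤ k := by positivity
  set η : ℝ := min (min (ε / 2) 1) (min (1 / (8 * Real.sqrt 2 * K + 1)) (1 / (2048 * k * N₀ ^ 2 + 1)))
    with hηdef
  have hη0 : 0 < η := lt_min (lt_min (by positivity) one_pos) (lt_min (by positivity) (by positivity))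
  have hηε : η ≤ ε / 2 := (min_le_left _ _).trans (min_le_left _ _)
  have hη1 : η ≤ 1 := (min_le_left _ _).trans (min_le_right _ _)
  have hηK : 2 * Real.sqrt 2 * K * η ≤ 1 / 4 := by
    have h1 : η ≤ 1 / (8 * Real.sqrt 2 * K + 1) := (min_le_right _ _).trans (min_le_left _ _)
    have hpos : 0 < 8 * Real.sqrt 2 * K + 1 := by positivity
    rw [le_div_iff₀ hpos] at h1
    nlinarith [mul_nonneg (Real.sqrt_nonneg 2) hK0]
  have hηN : 2048 * k * N₀ ^ 2 * η ≤ 1 := by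
    have h1 : η ≤ 1 / (2048 * k * N₀ ^ 2 + 1) := (min_le_right _ _).trans (min_le_right _ _)
    have hpos : 0 < 2048 * k * N₀ ^ 2 + 1 := by positivity
    rw [le_div_iff₀ hpos] at h1
    nlinarith [mul_nonneg hk0 (sq_nonneg N₀)]
  -- ### Step 2: heat decay: `‖e^{σΔ}ũ₀‖₃ < η` for `σ ≥ s`
  obtain ⟨s, hs⟩ : ∃ s : ℝ, ∀ σ ≥ s,
      eLpNorm (UnboundedOperators.heatExtension ũ₀ σ) 3 volume < ENNReal.ofReal η := by
    have h := (tendsto_eLpNorm_heatExtension_three_atTop hũ₀3).eventually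
      (eventually_lt_nhds (ENNReal.ofReal_pos.2 hη0))
    exact eventually_atTop.1 h
  set a : ℝ := max s 0 + 1 with hadef
  have ha1 : 1 ≤ a := by rw [hadef]; linarith [le_max_right s 0]
  have ha0 : 0 < a := by linarith
  have hheat : ∀ τ, a ≤ τ → eLpNorm (heatFlow ũ₀ τ) 3 volume ≤ ENNReal.ofReal η := by
    intro τ hτ
    have hτ0 : 0 < τ := by linarith
    have hτs : s ≤ τ := by rw [hadef] at hτ; linarith [le_max_left s 0]
    rw [heatFlow_of_pos _ hτ0]
    exact (hs τ hτs).le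
  -- ### Step 3: the energy of the remainder at time `a` is finite
  set Y₀ : ℝ≥0∞ := ∫⁻ x, ‖U a x - heatFlow ũ₀ (1 * a) x‖ₑ ^ 2 with hY₀
  have hY₀fin : Y₀ < ⊤ := by
    have hK2 := hU (a + 2) (by positivity)
    have hS : (0 : ℝ) < a + 1 := by positivity
    have hST : a + 1 < a + 2 := by linarith
    obtain ⟨p, -, hp32, -, -, hsuit⟩ := hK2.exists_rieszPressure_suitable_slab one_pos hS hST
    obtain ⟨G, hG, hG2, hLEI⟩ := hsuit.localEnergy
    have hNS := hsuit.distributional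
    have hu3 := hK2.memLp_three_strip hST
    have hcontS : ContinuousInLpOn (Ico 0 (a + 1)) 3 U :=
      hK2.continuousInLpOn.mono (Ico_subset_Ico_right hST.le)
    have hinit : U 0 =ᵐ[volume] ũ₀ := by rw [hK2.initial]; exact hae₀
    have hM0 : 0 ≤ max M 0 := le_max_right _ _
    obtain ⟨h1, -⟩ := caloric_remainder_energy_bound_ae one_pos hS hM0 hMb hũ₀3 hdiv₀ hNS hG hG2
      hLEI hu3 hp32 hcontS hinit (t := a) ⟨ha0, by linarith⟩
    exact h1.trans_lt ENNReal.ofReal_lt_top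
  set y₀ : ℝ := Y₀.toReal with hy₀
  have hy₀0 : 0 ≤ y₀ := ENNReal.toReal_nonneg
  have hY₀eq : Y₀ = ENNReal.ofReal y₀ := (ENNReal.ofReal_toReal hY₀fin.ne).symm
  -- ### Step 4: the window `[a, b]`, `b = a + L`, `T = b + 1`, the classical representative
  set L : ℝ := max a (16 * k * y₀ ^ 2 / (ε / 2) ^ 4 + 1) with hLdef
  have hLa : a ≤ L := le_max_left _ _
  have hL0 : 0 < L := ha0.trans_le hLa
  have hLy : 16 * k * y₀ ^ 2 ≤ L * (ε / 2) ^ 4 := by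
    have hε4 : 0 < (ε / 2) ^ 4 := by positivity
    have h1 : 16 * k * y₀ ^ 2 / (ε / 2) ^ 4 + 1 ≤ L := le_max_right _ _
    have h2 : 16 * k * y₀ ^ 2 / (ε / 2) ^ 4 * (ε / 2) ^ 4 = 16 * k * y₀ ^ 2 :=
      div_mul_cancel₀ _ hε4.ne'
    nlinarith
  set b : ℝ := a + L with hbdef
  have hab : a < b := by rw [hbdef]; linarith
  have hb2L : b ≤ 2 * L := by rw [hbdef]; linarith
  have hb0 : 0 ≤ b := by linarith
  set T : ℝ := b + 1 with hTdef
  have hbT : b < T := by rw [hTdef]; linarith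
  have hT : 0 < T := by linarith
  have hKT := hU T hT
  obtain ⟨w, π, hcl, hwu⟩ := mild_L3_smooth_holds one_pos hT (hKT.memLp_initial hT)
    (hKT.isWeaklyDivFree_initial hT) hKT.mild hKT.continuousInLpOn hKT.aestronglyMeasurable
  -- the caloric background and the remainder
  set e : ℝ → EuclideanSpace ℝ (Fin 3) → EuclideanSpace ℝ (Fin 3) :=
    fun t x => heatFlow ũ₀ (1 * t) x with hedef
  have he : IsSmoothSpaceTimeOn (Ioo 0 T) e := caloric_isSmoothSpaceTimeOn hũ₀3 one_pos T
  have hV : IsSmoothSpaceTimeOn (Ioo 0 T) fun t x => w t x - e t x := hcl.smooth_velocity.sub he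
  have hsmall : ∀ τ ∈ Icc a b,
      2 * Real.sqrt 2 * K * (eLpNorm (heatFlow ũ₀ (1 * τ)) 3 volume).toReal ≤ 1 / 4 := by
    intro τ hτ
    have h1 : (eLpNorm (heatFlow ũ₀ (1 * τ)) 3 volume).toReal ≤ η := by
      rw [one_mul]
      exact ENNReal.toReal_le_of_le_ofReal hη0.le (hheat τ hτ.1)
    calc 2 * Real.sqrt 2 * K * (eLpNorm (heatFlow ũ₀ (1 * τ)) 3 volume).toReal
        ≤ 2 * Real.sqrt 2 * K * η := mul_le_mul_of_nonneg_left h1 (by positivity)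
      _ ≤ 1 / 4 := hηK
  -- ### Step 5: the window inequality on `[a, τ]` for `τ ∈ (a, b]`
  set E4 : ℝ≥0∞ := ENNReal.ofReal (2 * Real.sqrt b * η ^ 3 * N₀) with hE4
  have hE4le : ∫⁻ τ in Ioo a b, ∫⁻ x, ‖heatFlow ũ₀ (1 * τ) x‖ₑ ^ 4 ≤ E4 :=
    lintegral_heatFlow_pow_four_le hũ₀3 hη0.le ha1 hab.le fun τ hτ => hheat τ hτ.1
  set Wr : ℝ := y₀ + 8 * Real.sqrt b * η ^ 3 * N₀ with hWr
  have hWr0 : 0 ≤ Wr := by positivity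
  set W : ℝ≥0∞ := ENNReal.ofReal Wr with hWdef
  have hWeq : Y₀ + ENNReal.ofReal (4 / 1) * E4 = W := by
    rw [hY₀eq, hE4, hWdef, hWr, ← ENNReal.ofReal_mul (by norm_num),
      ← ENNReal.ofReal_add hy₀0 (by positivity)]
    congr 1
    ring
  have hYa : ∫⁻ x, ‖w a x - heatFlow ũ₀ (1 * a) x‖ₑ ^ 2 = Y₀ := by
    have haS : a ∈ Ioo 0 T := ⟨ha0, hab.trans hbT⟩
    refine lintegral_congr_ae ?_
    filter_upwards [hwu a haS] with x hx
    rw [hx]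
  have hwin : ∀ τ ∈ Ioc a b,
      (∫⁻ x, ‖w τ x - heatFlow ũ₀ (1 * τ) x‖ₑ ^ 2) +
        ∫⁻ σ in Ioo a τ, ∫⁻ x, ENNReal.ofReal
          (frobeniusNormSq (fderiv ℝ (fun y => w σ y - heatFlow ũ₀ (1 * σ) y) x)) ≤ W := by
    intro τ hτ
    have hτT : τ < T := hτ.2.trans_lt hbT
    have h := kato_remainder_window_inequality one_pos hKT hae₀ hMb hcl hwu ha0 hτ.1.le hτT
      (fun σ hσ => hsmall σ ⟨hσ.1, hσ.2.trans hτ.2⟩)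
    rw [ENNReal.ofReal_one, one_mul (M := ℝ≥0∞), hYa] at h
    refine h.trans ?_
    rw [← hWeq]
    gcongr
    exact (lintegral_mono_set (Ioo_subset_Ioo_right hτ.2)).trans hE4le
  -- ### Step 6: averaging in time
  set θ : ℝ := (ε / 2) ^ 4 / (4 * (k * Wr + 1)) with hθ
  have hθ0 : 0 < θ := by positivity
  obtain ⟨τ, hτ, hDτ⟩ := exists_mem_Ioo_le_of_setLIntegral_le hab ENNReal.ofReal_ne_top
    (le_add_self.trans (hwin b ⟨hab, le_rfl⟩)) hθ0
  have hτS : τ ∈ Ioo 0 T := ⟨ha0.trans hτ.1, hτ.2.trans hbT⟩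
  -- ### Step 7: the slice bound at `τ`
  set Vτ : EuclideanSpace ℝ (Fin 3) → EuclideanSpace ℝ (Fin 3) :=
    fun y => w τ y - heatFlow ũ₀ (1 * τ) y with hVτ
  have hVτ1 : ContDiff ℝ 1 Vτ := (hV.contDiff_slice hτS).of_le (by norm_cast)
  have hYτ : ∫⁻ x, ‖Vτ x‖ₑ ^ 2 ≤ W := le_self_add.trans (hwin τ ⟨hτ.1, hτ.2.le⟩)
  have hYτfin : ∫⁻ x, ‖Vτ x‖ₑ ^ 2 < ⊤ := hYτ.trans_lt ENNReal.ofReal_lt_top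
  have h4 : eLpNorm Vτ 3 volume ^ (4 : ℝ) ≤ ENNReal.ofReal ((ε / 2) ^ 4) := by
    calc eLpNorm Vτ 3 volume ^ (4 : ℝ)
        ≤ (Ks : ℝ≥0∞) ^ 2 * (∫⁻ x, ‖Vτ x‖ₑ ^ 2) *
            ∫⁻ x, ENNReal.ofReal (frobeniusNormSq (fderiv ℝ Vτ x)) :=
          eLpNorm_three_rpow_four_le hVτ1 hYτfin
      _ ≤ (Ks : ℝ≥0∞) ^ 2 * W * (W / ENNReal.ofReal (b - a) + ENNReal.ofReal θ) := by
          gcongr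
      _ = ENNReal.ofReal (k * Wr * (Wr / L + θ)) := by
          rw [hWdef, hk, show b - a = L by rw [hbdef]; ring, ← ENNReal.ofReal_div_of_pos hL0,
            ← ENNReal.ofReal_add (div_nonneg hWr0 hL0.le) hθ0.le, ← ENNReal.ofReal_coe_nnreal,
            ← ENNReal.ofReal_pow (NNReal.coe_nonneg _), ← ENNReal.ofReal_mul (sq_nonneg _),
            ← ENNReal.ofReal_mul (mul_nonneg (sq_nonneg _) hWr0)]
      _ ≤ ENNReal.ofReal ((ε / 2) ^ 4) := ENNReal.ofReal_le_ofReal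
          (decay_arith hk0 hN₀0 hy₀0 hη0.le hη1 hηε hηN hL0 hb2L hb0 hLy hθ)
  have h3 : eLpNorm Vτ 3 volume ≤ ENNReal.ofReal (ε / 2) := by
    rw [ENNReal.ofReal_pow (by positivity), ← ENNReal.rpow_ofNat] at h4
    exact (ENNReal.rpow_le_rpow_iff (by norm_num)).1 h4
  -- ### Step 8: conclusion at `t₀ = τ + t₁`
  refine ⟨τ + t₁, by linarith [hτ.1], ?_⟩
  have hmeasV : AEStronglyMeasurable Vτ volume := hVτ1.continuous.aestronglyMeasurable
  have hmease : AEStronglyMeasurable (heatFlow ũ₀ (1 * τ)) volume :=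
    (memLp_heatFlow_holds hũ₀3 (by norm_num) (by rw [one_mul]; exact (ha0.trans hτ.1).le)).1
  have hwτ : w τ = Vτ + heatFlow ũ₀ (1 * τ) := by
    funext x
    simp only [hVτ, Pi.add_apply, sub_add_cancel]
  calc eLpNorm (u (τ + t₁)) 3 volume = eLpNorm (w τ) 3 volume := (eLpNorm_congr_ae (hwu τ hτS)).symm
    _ ≤ eLpNorm Vτ 3 volume + eLpNorm (heatFlow ũ₀ (1 * τ)) 3 volume := by
        rw [hwτ]
        exact eLpNorm_add_le hmeasV hmease (by norm_num)
    _ ≤ ENNReal.ofReal (ε / 2) + ENNReal.ofReal η :=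
        add_le_add h3 (by rw [one_mul]; exact hheat τ hτ.1.le)
    _ ≤ ENNReal.ofReal (ε / 2) + ENNReal.ofReal (ε / 2) := add_le_add le_rfl (ENNReal.ofReal_le_ofReal hηε)
    _ = ENNReal.ofReal ε := by
        rw [← ENNReal.ofReal_add (by positivity) (by positivity)]
        congr 1
        ring

end Decay

end GIP2003

end Literature.Analysis.FluidPDE

end
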